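import Summits.AtomisticToContinuum.Crystallization.Theorems.FreeSplittingCertificatesStrictSplittingRuleTorusModel442Dual
import Summits.AtomisticToContinuum.Crystallization.Theorems.FreeSplittingCertificatesStrictSplittingRuleTorusModel552Dual
import Summits.AtomisticToContinuum.Crystallization.Theorems.FreeSplittingCertificatesStrictSplittingRuleTorusModel663Dual
import Summits.AtomisticToContinuum.Crystallization.Theorems.FreeSplittingCertificatesStrictSplittingRuleTorusModel884Dual
import Summits.AtomisticToContinuum.Crystallization.Theorems.FreeSplittingCertificatesStrictSplittingRuleTorusModel10105Dual
import Summits.AtomisticToContinuum.Crystallization.Theorems.FreeSplittingCertificatesStrictSplittingRuleTorusModelTransferZeroSum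

/-!
# Dual side, corollaries: monotonicity in the κ-scaling and the table format of the primal certificates

Route `FreeSplittingCertificates`, crux `StrictSplittingRule` (stmt-AtomisticToContinuum-12560); unit b2b-freesplit-B (block 2b,
PART B, gen 2).  **VALUE = theorems about FINITE models — NOT summit progress.**

* `kappaS_nonneg`, `siteSum_neg_mono`: the κ-demand is a sum of squares, so a dual witness at `λ` is a dual witness at every `λ' ≥ λ`;
  `not_exists_zeroSum_jointLMI_of_le`, `not_exists_tables_jointLMI_of_le` (the latter with the structural zero-sum theorem
  `transfer_siteSum_zero` of `…TorusModelTransferZeroSum.lean` for the certificate's own transfer format `transferTermsG`).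
* Instances: on the 4×4×2 / 5×5×2 / 6×6×3 / 8×8×4 / 10×10×5 tori, for EVERY `λ ≥ 13/5, 5/2, 12/5, 9/4, 11/5` respectively there is
  neither a zero-sum transfer assignment (`not_exists_zeroSum_jointLMI<size>_of_le`) nor a consistent class list of transfer tables of any
  stencil, range or entries (`not_exists_tables_jointLMI<size>`) under which `λ·K_p + R_p ≤ S_p + T_p + meanProj` holds at every site —
  the format in which the primal certificates of gens 0–1 (`jointLMI442A/B`, `…_kappaDoubled`, `jointLMI552A/B`, CERT.md §0/§8b) ARE
  written.  In particular the "λ = 3 not certifiable" optimiser finding of CERT.md §8 (6×6×3, kit j037941) is now a theorem: infeasible.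
COMPUTATIONAL regime (inherits the `native_decide` witness evaluations of `…TorusModel<size>Dual.lean`).
-/

namespace Summit.AtomisticToContinuum.Crystallization.Theorems.StrictSplittingRuleTorusLMI

open Literature.Computation.Certificates

section Generic

variable (NK N1 : ℕ) [NeZero NK] [NeZero N1]

omit [NeZero NK] [NeZero N1] in
/-- The co-rotated squared residual of a bond is nonnegative. [folklore] -/
theorem bondVals_fst_nonneg (u : Fin (dimG NK N1) → ℚ) (m q : SiteG NK N1) (t0 t1 t2 y0 y1 y2 : ℚ) :
    0 ≤ (bondVals NK N1 u m q t0 t1 t2 y0 y1 y2).1 := by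
  simp only [bondVals]
  nlinarith [mul_self_nonneg (u (idxG NK N1 q 0) - u (idxG NK N1 m 0) - (y1 * t0 + y2 * t1)),
    mul_self_nonneg (u (idxG NK N1 q 1) - u (idxG NK N1 m 1) - (y2 * t2 - y0 * t0) / 3),
    mul_self_nonneg (u (idxG NK N1 q 2) - u (idxG NK N1 m 2) + (y0 * t1 + y1 * t2))]

/-- The κ-demand is nonnegative (a sum of squares with the positive weights `κ₁ = 1/3`, `κ₃ = 1/12`). [folklore] -/
theorem kappaS_nonneg (p : SiteG NK N1) (v : Fin (dimG NK N1) → ℚ) : 0 ≤ kappaS NK N1 p v := by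
  rw [kappaS_eq_eval]
  unfold evalKappa
  refine List.sum_nonneg ?_
  intro x hx
  rw [List.mem_map] at hx
  obtain ⟨r, -, rfl⟩ := hx
  dsimp only
  exact add_nonneg (mul_nonneg (by norm_num [kappa1]) (sq_nonneg _))
    (mul_nonneg (by norm_num [kappa3]) (bondVals_fst_nonneg NK N1 _ _ _ _ _ _ _ _ _))

/-- **Monotonicity in the κ-scaling**: a negative site-balance sum at `λ` stays negative at every `λ' ≥ λ`. [folklore] -/
theorem siteSum_neg_mono {lam lam' : ℚ} (h : lam ≤ lam') (u : Fin (dimG NK N1) → ℚ)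
    (hneg : ∑ p, siteBalance NK N1 lam p u < 0) : ∑ p, siteBalance NK N1 lam' p u < 0 := by
  refine lt_of_le_of_lt (Finset.sum_le_sum fun p _ => ?_) hneg
  simp only [siteBalance]
  nlinarith [kappaS_nonneg NK N1 p u]

/-- Weak duality for every `λ' ≥ λ`: no zero-sum transfer assignment makes the `λ'`-scaled LMI hold at every site. [folklore] -/
theorem not_exists_zeroSum_jointLMI_of_le {lam lam' : ℚ} (h : lam ≤ lam') (u : Fin (dimG NK N1) → ℚ)
    (hneg : ∑ p, siteBalance NK N1 lam p u < 0) :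
    ¬ ∃ T : SiteG NK N1 → (Fin (dimG NK N1) → ℚ) → ℚ, (∀ v, ∑ p, T p v = 0) ∧
      ∀ (p : SiteG NK N1) (v : Fin (dimG NK N1) → ℚ),
        lam' * kappaS NK N1 p v + readoutS NK N1 p v ≤ supplyS NK N1 p v + T p v + meanProjS NK N1 v := by
  rintro ⟨T, hT, hall⟩
  exact not_jointLMI_of_siteSum_neg NK N1 lam' u (siteSum_neg_mono NK N1 h u hneg) T (hT u) hall

/-- The table-format version for every `λ' ≥ λ` (even number of layers, consistent classes, any tables). [folklore] -/
theorem not_exists_tables_jointLMI_of_le (hNK : 2 ∣ NK) {lam lam' : ℚ} (h : lam ≤ lam') (u : Fin (dimG NK N1) → ℚ)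
    (hneg : ∑ p, siteBalance NK N1 lam p u < 0) :
    ¬ ∃ tcls : List (Bool × Off × Bool × Bool × List ℤ), (∀ cl ∈ tcls, cl.2.2.1 = (if cl.2.1.1 % 2 = 0 then cl.1 else !cl.1)) ∧
      ∀ (p : SiteG NK N1) (v : Fin (dimG NK N1) → ℚ), lam' * kappaS NK N1 p v + readoutS NK N1 p v ≤
        supplyS NK N1 p v + evalQ (transferTermsG NK N1 p tcls) v + meanProjS NK N1 v :=
  not_exists_tables_jointLMI_of_siteSum_neg NK N1 hNK lam' u (siteSum_neg_mono NK N1 h u hneg)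

end Generic

/-- **4×4×2 torus: for every `λ ≥ 13/5` no zero-sum transfer family makes the `λ`-scaled sitewise LMI hold at every site.** -/
theorem not_exists_zeroSum_jointLMI442_of_le (lam : ℚ) (h : 13 / 5 ≤ lam) :
    ¬ ∃ T : SiteG 4 4 → (Fin (dimG 4 4) → ℚ) → ℚ, (∀ v, ∑ p, T p v = 0) ∧
      ∀ (p : SiteG 4 4) (v : Fin (dimG 4 4) → ℚ),
        lam * kappaS 4 4 p v + readoutS 4 4 p v ≤ supplyS 4 4 p v + T p v + meanProjS 4 4 v :=
  not_exists_zeroSum_jointLMI_of_le 4 4 h u442 siteSum442_neg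

/-- **4×4×2 torus: for every `λ ≥ 13/5` no consistent class list of transfer tables (the certificate format: any stencil, range,
entries) makes the `λ`-scaled sitewise LMI hold at every site.** -/
theorem not_exists_tables_jointLMI442 (lam : ℚ) (h : 13 / 5 ≤ lam) :
    ¬ ∃ tcls : List (Bool × Off × Bool × Bool × List ℤ), (∀ cl ∈ tcls, cl.2.2.1 = (if cl.2.1.1 % 2 = 0 then cl.1 else !cl.1)) ∧
      ∀ (p : SiteG 4 4) (v : Fin (dimG 4 4) → ℚ), lam * kappaS 4 4 p v + readoutS 4 4 p v ≤
        supplyS 4 4 p v + evalQ (transferTermsG 4 4 p tcls) v + meanProjS 4 4 v :=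
  not_exists_tables_jointLMI_of_le 4 4 ⟨2, rfl⟩ h u442 siteSum442_neg

/-- **5×5×2 torus: for every `λ ≥ 5/2` no zero-sum transfer family makes the `λ`-scaled sitewise LMI hold at every site.** -/
theorem not_exists_zeroSum_jointLMI552_of_le (lam : ℚ) (h : 5 / 2 ≤ lam) :
    ¬ ∃ T : SiteG 4 5 → (Fin (dimG 4 5) → ℚ) → ℚ, (∀ v, ∑ p, T p v = 0) ∧
      ∀ (p : SiteG 4 5) (v : Fin (dimG 4 5) → ℚ),
        lam * kappaS 4 5 p v + readoutS 4 5 p v ≤ supplyS 4 5 p v + T p v + meanProjS 4 5 v :=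
  not_exists_zeroSum_jointLMI_of_le 4 5 h u552 siteSum552_neg

/-- **5×5×2 torus: for every `λ ≥ 5/2` no consistent class list of transfer tables (the certificate format: any stencil, range,
entries) makes the `λ`-scaled sitewise LMI hold at every site.** -/
theorem not_exists_tables_jointLMI552 (lam : ℚ) (h : 5 / 2 ≤ lam) :
    ¬ ∃ tcls : List (Bool × Off × Bool × Bool × List ℤ), (∀ cl ∈ tcls, cl.2.2.1 = (if cl.2.1.1 % 2 = 0 then cl.1 else !cl.1)) ∧
      ∀ (p : SiteG 4 5) (v : Fin (dimG 4 5) → ℚ), lam * kappaS 4 5 p v + readoutS 4 5 p v ≤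
        supplyS 4 5 p v + evalQ (transferTermsG 4 5 p tcls) v + meanProjS 4 5 v :=
  not_exists_tables_jointLMI_of_le 4 5 ⟨2, rfl⟩ h u552 siteSum552_neg

/-- **6×6×3 torus: for every `λ ≥ 12/5` no zero-sum transfer family makes the `λ`-scaled sitewise LMI hold at every site.** -/
theorem not_exists_zeroSum_jointLMI663_of_le (lam : ℚ) (h : 12 / 5 ≤ lam) :
    ¬ ∃ T : SiteG 6 6 → (Fin (dimG 6 6) → ℚ) → ℚ, (∀ v, ∑ p, T p v = 0) ∧
      ∀ (p : SiteG 6 6) (v : Fin (dimG 6 6) → ℚ),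
        lam * kappaS 6 6 p v + readoutS 6 6 p v ≤ supplyS 6 6 p v + T p v + meanProjS 6 6 v :=
  not_exists_zeroSum_jointLMI_of_le 6 6 h u663 siteSum663_neg

/-- **6×6×3 torus: for every `λ ≥ 12/5` no consistent class list of transfer tables (the certificate format: any stencil, range,
entries) makes the `λ`-scaled sitewise LMI hold at every site.** -/
theorem not_exists_tables_jointLMI663 (lam : ℚ) (h : 12 / 5 ≤ lam) :
    ¬ ∃ tcls : List (Bool × Off × Bool × Bool × List ℤ), (∀ cl ∈ tcls, cl.2.2.1 = (if cl.2.1.1 % 2 = 0 then cl.1 else !cl.1)) ∧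
      ∀ (p : SiteG 6 6) (v : Fin (dimG 6 6) → ℚ), lam * kappaS 6 6 p v + readoutS 6 6 p v ≤
        supplyS 6 6 p v + evalQ (transferTermsG 6 6 p tcls) v + meanProjS 6 6 v :=
  not_exists_tables_jointLMI_of_le 6 6 ⟨3, rfl⟩ h u663 siteSum663_neg

/-- **8×8×4 torus: for every `λ ≥ 9/4` no zero-sum transfer family makes the `λ`-scaled sitewise LMI hold at every site.** -/
theorem not_exists_zeroSum_jointLMI884_of_le (lam : ℚ) (h : 9 / 4 ≤ lam) :
    ¬ ∃ T : SiteG 8 8 → (Fin (dimG 8 8) → ℚ) → ℚ, (∀ v, ∑ p, T p v = 0) ∧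
      ∀ (p : SiteG 8 8) (v : Fin (dimG 8 8) → ℚ),
        lam * kappaS 8 8 p v + readoutS 8 8 p v ≤ supplyS 8 8 p v + T p v + meanProjS 8 8 v :=
  not_exists_zeroSum_jointLMI_of_le 8 8 h u884 siteSum884_neg

/-- **8×8×4 torus: for every `λ ≥ 9/4` no consistent class list of transfer tables (the certificate format: any stencil, range,
entries) makes the `λ`-scaled sitewise LMI hold at every site.** -/
theorem not_exists_tables_jointLMI884 (lam : ℚ) (h : 9 / 4 ≤ lam) :
    ¬ ∃ tcls : List (Bool × Off × Bool × Bool × List ℤ), (∀ cl ∈ tcls, cl.2.2.1 = (if cl.2.1.1 % 2 = 0 then cl.1 else !cl.1)) ∧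
      ∀ (p : SiteG 8 8) (v : Fin (dimG 8 8) → ℚ), lam * kappaS 8 8 p v + readoutS 8 8 p v ≤
        supplyS 8 8 p v + evalQ (transferTermsG 8 8 p tcls) v + meanProjS 8 8 v :=
  not_exists_tables_jointLMI_of_le 8 8 ⟨4, rfl⟩ h u884 siteSum884_neg

/-- **10×10×5 torus: for every `λ ≥ 11/5` no zero-sum transfer family makes the `λ`-scaled sitewise LMI hold at every site.** -/
theorem not_exists_zeroSum_jointLMI10105_of_le (lam : ℚ) (h : 11 / 5 ≤ lam) :
    ¬ ∃ T : SiteG 10 10 → (Fin (dimG 10 10) → ℚ) → ℚ, (∀ v, ∑ p, T p v = 0) ∧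
      ∀ (p : SiteG 10 10) (v : Fin (dimG 10 10) → ℚ),
        lam * kappaS 10 10 p v + readoutS 10 10 p v ≤ supplyS 10 10 p v + T p v + meanProjS 10 10 v :=
  not_exists_zeroSum_jointLMI_of_le 10 10 h u10105 siteSum10105_neg

/-- **10×10×5 torus: for every `λ ≥ 11/5` no consistent class list of transfer tables (the certificate format: any stencil, range,
entries) makes the `λ`-scaled sitewise LMI hold at every site.** -/
theorem not_exists_tables_jointLMI10105 (lam : ℚ) (h : 11 / 5 ≤ lam) :
    ¬ ∃ tcls : List (Bool × Off × Bool × Bool × List ℤ), (∀ cl ∈ tcls, cl.2.2.1 = (if cl.2.1.1 % 2 = 0 then cl.1 else !cl.1)) ∧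
      ∀ (p : SiteG 10 10) (v : Fin (dimG 10 10) → ℚ), lam * kappaS 10 10 p v + readoutS 10 10 p v ≤
        supplyS 10 10 p v + evalQ (transferTermsG 10 10 p tcls) v + meanProjS 10 10 v :=
  not_exists_tables_jointLMI_of_le 10 10 ⟨5, rfl⟩ h u10105 siteSum10105_neg

end Summit.AtomisticToContinuum.Crystallization.Theorems.StrictSplittingRuleTorusLMI
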